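import Literature.MathematicalPhysics.QuantumFieldTheory.Balaban1983to89.B5AverageCurlStokesV1
import Summits.QuantumFields.YangMills.Theorems.UnitScaleTiltProp7IterLinRightInverse
import Summits.QuantumFields.YangMills.Theorems.UnitScaleTiltProp8ChartHInvComb

/-!
# BalabanUVNodes ∕ N12 — THE (J-b) JUNCTION «U2b ↔ `bondAvgIter` ∕ `linAvg`» AT THE FLAT BACKGROUND, V1 CURRENCY:
# a RIGHT INVERSE `H` of the k-fold LINEARISED (0.4)-constraint `Q^{(k)}` («`DΨ(0)∘H = id`», the defining property of the flat linearised
# minimiser `H⁰_{1,k}` in dag-n12-w3's `B11Eq177CriticalFamilyDerivative.fderiv_flatCriticalExpChartFamily_eq`) makes «the k-fold linearised averages of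
# `H X` reproduce `X`», hence — by dag-n12-w4's localized Federbush chain estimate `B5AverageCurlStokesV1.sum_normSq_oc_chain_le` — the PLAQUETTE ENERGY OF
# THE COARSE DATUM NEAR `Λ` IS DOMINATED BY THAT OF ITS LINEARISED MINIMISER («averaging decreases the action», [Federbush1986PhaseCellI] (0.12);
# the lower comparison behind [Balaban1989LargeFieldII] (1.7) at `γ₀ = 1`), constant exactly `(c²L²∕L^d)^k` — `= 1` at `d = 4`, `c = L`

Cell `pub-ymgap` (HUMAN RULINGS D-0062 ∕ D-0149), width seat `pub-ymgap-dag-n10-w1` g0 re-pointed by plan g80 WORDS-1b (bus l.25728: «CANDIDATE № 10 = START-LIST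
§n12 (J-b)»); dag-n12-w4's ROUTE-NOTE l.25435 names the junction.  Key K1⁷ `stmt-QuantumFields-20542`, `--kind proof --supports … --as helper`; count-neutral;
THEOREMS ONLY (0 `def`, 0 `sorry`, 0 `instance`); CONSUMED BY NAME, nothing modified: `B5AverageCurlStokesV1.{oc_linAvg, sum_normSq_oc_chain_le,
sum_plaq_normSq_oc_chain_le}` (dag-n12-w4, p588510), `B6StairStokesTorus.oc`, `LatticeFieldCalculus.{bondAvg, bondAvgIter}`, `BlockAveragingEMLLinearised.linAvg`
(NODE 00's linearised (0.4) average), and the route UnitScaleTilt's recursion letter for `Q^{(k)} = Q₁∘⋯∘Q₁` with its right inverse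
`Summit.….Prop7AvgLinearisation.exists_rightInverse_iterLin` (constant 1).

THE PRINT.  [Balaban1989LargeFieldII] p. 357: *«Let us consider the function B′ → A(U_{k,Z}((exp iB′)V_k)) … H_{1,k} is the linearised minimiser»*, (1.7) p. 358
`⟨B′, Δ_kB′⟩ ≧ γ₀⟨H_{1,k}B′, Δ₁H_{1,k}B′⟩`-type comparison (read at flat background with `γ₀ = 1` on the route of dag-n12-w4's four files);
[Balaban1985Variational] (36)–(47) pp. 283–285 (the linearised minimiser `H` reproduces the linearised datum: `Q(HB) = B`, (45) «L^jηQ_jHB = B on Λ_j»);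
[Federbush1986PhaseCellI] 'Abelian Stability Theorem' (0.12) p. 321 («averaging decreases the action»); [Balaban1984PropagatorsI] (1.18) p. 20 (`Q_k`),
(1.21) p. 21; [Balaban1985Averaging] (124)–(125) p. 36 (the linearised (0.4) average = `L·Q` minus a coarse pure gauge).

WHAT «`DΨ(0)∘H = id`» SAYS IN V1 CURRENCY.  With `Q : (i : ℕ) → VecField P 0 V → VecField P i V` the k-fold linearised constraint given by its RECURSION
(`Q 0 A = A`, `Q (i+1) A = linAvg (Q i A)` — the tree's letter for `Q^{(k)}`, which IS the derivative of the k-fold (0.4)-descent at the flat configuration by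
`Prop7AvgLinearisation.norm_iter_sub_one_sub_iterLin_le`; the identification with `fderiv (msChart … 1) 0` is module B of this seat), a right inverse `H`
(`Q k (H X) = X`) is EXACTLY «the k-fold linearised averages of `H X` reproduce `X`» — and since `oc (linAvg Y) = L • oc (bondAvg Y)` (`oc_linAvg`: the gauge tails of
the comb means carry no plaquette variable), the chain `Y_i := Q i (H X)` satisfies the plaquette law of `sum_normSq_oc_chain_le` with `c = L` EVERYWHERE, a fortiori
on the plaquettes near `Λ`.

CONTENTS.
§1 (matrix fields, norm-free) `oc_iterLin_succ` — the plaquette law `oc (Q (i+1) A) μ ν y = L • oc (bondAvg (Q i A)) μ ν y` of the `linAvg`-recursion family (real scalar `L`).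
§2 (ANY real normed `V`; the recursion enters only through its plaquette law `hQoc` with a constant `c`) ★★ `sum_normSq_oc_le_of_rightInverse`
   (`(L^d)^k·Σ_{y∈S_k}‖oc X μ ν y‖² ≤ (c²L²)^k·Σ_{x∈S_0}‖oc (H X) μ ν x‖²` down nested stencils `S_i`, for EVERY right inverse `H` of `Q k`), ★
   `sum_normSq_oc_le_of_agreeOn` (the ON-`S_k`-ONLY edition: any fine `A` whose `Q k A` has the plaquette variables of `X` on `S_k` — «reproduce `X` on the plaquettes
   near `Λ`» literally), `sum_normSq_oc_le_of_rightInverse_univ` (all plaquettes), ★ `sum_normSq_oc_le_of_rightInverse_dfour` (`d = 4`, `c = L`: constant 1),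
   ★ `sum_plaq_normSq_oc_le_of_rightInverse` (plaquette-indexed, weighted — the shape pairing with NODE 00's `Σ_{p : Plaq}` second variation).
§2½ (TRANSPORT along a real-linear chart `φ` of the value space — the `𝔰𝔲(2) → ℝ³` coordinates of the N12∕s1 slice): `oc_comp_linearMap` (+ the route UnitScaleTilt's
   `ChartHInv.bondAvg_comp_apply` by name), `plaquetteLaw_comp_linearMap`, `oc_congr`, ★★ `chainLaw_iterLin_comp_linearMap` (the `W`-valued chain `Y i := φ ∘ Q i A` satisfies dag-n12-w4's binder `hY` of
   `B16Ineq17FlatRouteConstants.gamma0_circ_le_of_flat_chain` with `c = L` on EVERY plaquette), ★ `oc_iterLin_comp_eq_of_reproduce` (its binder `hYk` from the matrix-level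
   reproduction `Q k A = X` on the four bonds of the plaquette).
§3 (matrix fields) `plaquetteLaw_of_iterLin` (§1 packaged as §2's `hQoc` with `c = L`), ★ `exists_rightInverse_iterLin_fun` (A6: the `H`-binder of §2 is INHABITED for the
   `linAvg`-recursion family — a right inverse AS A FUNCTION, by `exists_rightInverse_iterLin` + choice; sup-norm bound kept).

HONEST FRAMING.  By-name junction algebra: the recursion letter `Q`, the right inverse `H`, the stencil nesting `hS` are DISPLAYED hypotheses (inhabited by the cited tree
theorems); the identification `DΨ(0) = Q^{(k)}` for NODE 00's multi-scale chart at the flat datum is NOT here (module B); nothing of Bałaban's (1.7) ∕ (1.65)–(1.67) is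
asserted; the normed statements are generic in `V` (the matrix consumer chooses the norm scope — Frobenius for `Re Tr(σ⋆σ)`, or `Matrix.Norms.L2Operator` — and feeds §1's law);
N12 NOT discharged; count-neutral (typed 28∕28 · discharged 5∕27 unmoved); one finite 𝕋⁴ programme at fixed ε — R4 closes the conditional rung `BalabanLadder.UV` only; the
YM mass gap (Clay) is NOT proved by any of this.  No `sorry`, no `def`, no `instance`, no `notation`.
-/

noncomputable section

open scoped BigOperators
open Finset

namespace Summit.QuantumFields.YangMills.BalabanUVNodes.N12FlatConstraintPlaquetteJunction

open Literature.MathematicalPhysics.QuantumFieldTheory.Balaban1983to89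
open LatticeFieldCalculus
open B6StairStokesTorus (oc)
open B5AverageCurlStokesV1 (oc_linAvg sum_normSq_oc_chain_le sum_plaq_normSq_oc_chain_le)
open BlockAveragingEMLLinearised (linAvg)
open Summit.QuantumFields.YangMills.Theorems.Prop7AvgLinearisation (exists_rightInverse_iterLin)
open Summit.QuantumFields.YangMills.Theorems.ChartHInv (bondAvg_comp_apply)

variable {P : Params}

/-! ## §1  The plaquette law of the `linAvg`-recursion family (matrix fields, norm-free) -/

section MatrixLaw

variable {n : Type*} [Fintype n] [DecidableEq n] [Nonempty n]

omit [Fintype n] [DecidableEq n] [Nonempty n] in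
/-- A natural-number scalar on a matrix field value is the same through `ℂ` and through `ℝ`. [folklore] -/
private theorem natCast_smul_complex_eq_real (m : ℕ) (M : Matrix n n ℂ) : ((m : ℕ) : ℂ) • M = ((m : ℕ) : ℝ) • M := by
  rw [Nat.cast_smul_eq_nsmul, Nat.cast_smul_eq_nsmul]

/-- **THE PLAQUETTE LAW OF THE k-FOLD LINEARISED (0.4)-CONSTRAINT** (recursion-characterised `Q^{(k)}`: `Q (i+1) A = linAvg (Q i A)`): on every coarse plaquette
`oc (Q (i+1) A) μ ν y = L • oc (bondAvg (Q i A)) μ ν y` with the REAL scalar `L` — `B5AverageCurlStokesV1.oc_linAvg` read through the recursion (the comb-mean gauge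
tails of [Balaban1985Averaging] (124)–(125) carry no plaquette variable). [cite: Balaban1985Averaging, (124)-(125) p.36; Balaban1984PropagatorsI, (1.11) p.19, (1.18) p.20] -/
theorem oc_iterLin_succ (Q : (i : ℕ) → (PBond P 0 → Matrix n n ℂ) → PBond P i → Matrix n n ℂ)
    (hQs : ∀ (i : ℕ) (Y : PBond P 0 → Matrix n n ℂ) (c : PBond P (i + 1)), Q (i + 1) Y c = linAvg (Q i Y) c)
    (A : PBond P 0 → Matrix n n ℂ) (i : ℕ) (μ ν : Fin P.d) (y : Site P (i + 1)) :
    oc (Q (i + 1) A) μ ν y = (P.L : ℝ) • oc (bondAvg (Q i A)) μ ν y := by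
  have hfun : Q (i + 1) A = linAvg (Q i A) := funext (hQs i A)
  rw [hfun, oc_linAvg, natCast_smul_complex_eq_real]

end MatrixLaw

/-! ## §2  Federbush for a right inverse of the linearised constraint (any real normed value space `V`) -/

section RightInverse

variable {V : Type*} [NormedAddCommGroup V] [NormedSpace ℝ V]

/-- ★★ **«AVERAGING DECREASES THE ACTION» FOR THE LINEARISED MINIMISER, LOCALIZED.**  Let `Q : (i : ℕ) → VecField P 0 V → VecField P i V` satisfy `Q 0 A = A` and the
plaquette law `oc (Q (i+1) A) μ ν y = c • oc (bondAvg (Q i A)) μ ν y` (for the `linAvg`-recursion family: `c = L`, §1), and let `H` be a RIGHT INVERSE of `Q k`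
(`Q k (H X) = X` — [Balaban1985Variational] (45) ∕ the defining property `DΨ(0)(H y) = y` of the flat linearised minimiser in `fderiv_flatCriticalExpChartFamily_eq`).  Then
for every nested family of plaquette sets `S_i ⊂ T^{(i)}` (the stencil of every plaquette of `S_{i+1}` inside `S_i`) and every coarse datum `X`:
`(L^d)^k · Σ_{y∈S_k} ‖oc X μ ν y‖² ≤ (c²L²)^k · Σ_{x∈S_0} ‖oc (H X) μ ν x‖²`.
[cite: Federbush1986PhaseCellI, 'Abelian Stability Theorem' (0.12) p.321; Balaban1985Variational, (45) p.285; Balaban1989LargeFieldII, (1.7) p.358] -/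
theorem sum_normSq_oc_le_of_rightInverse (k : ℕ) (hk : k ≤ P.m + P.K) (c : ℝ) (Q : (i : ℕ) → VecField P 0 V → VecField P i V)
    (hQ0 : ∀ A, Q 0 A = A)
    (hQoc : ∀ (i : ℕ) (A : VecField P 0 V) (μ ν : Fin P.d) (y : Site P (i + 1)), oc (Q (i + 1) A) μ ν y = c • oc (bondAvg (Q i A)) μ ν y)
    (H : VecField P k V → VecField P 0 V) (hH : ∀ X, Q k (H X) = X) {μ ν : Fin P.d} (hμν : μ ≠ ν) (S : (i : ℕ) → Finset (Site P i))
    (hS : ∀ i, i < k → ∀ y ∈ S (i + 1), ∀ (r : Fin P.d → Fin P.L) (s t : ℕ), s < P.L → t < P.L →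
      runSite (runSite (Site.blockSite y r) μ s) ν t ∈ S i)
    (X : VecField P k V) :
    ((P.L : ℝ) ^ P.d) ^ k * ∑ y ∈ S k, ‖oc X μ ν y‖ ^ 2 ≤ (c ^ 2 * (P.L : ℝ) ^ 2) ^ k * ∑ x ∈ S 0, ‖oc (H X) μ ν x‖ ^ 2 := by
  have h := sum_normSq_oc_chain_le k hk c (fun i => Q i (H X)) hμν S hS (fun i _ y _ => hQoc i (H X) μ ν y)
  simpa only [hH X, hQ0] using h

/-- ★ **THE ON-`S_k`-ONLY EDITION** («the k-fold linearised averages of `A` reproduce `X` on the plaquettes near `Λ`», literally): if the plaquette variables of `X` and of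
`Q k A` agree on `S_k`, then `(L^d)^k · Σ_{y∈S_k} ‖oc X μ ν y‖² ≤ (c²L²)^k · Σ_{x∈S_0} ‖oc A μ ν x‖²`.
[cite: Federbush1986PhaseCellI, 'Abelian Stability Theorem' (0.12) p.321; Balaban1985Variational, (45) p.285] -/
theorem sum_normSq_oc_le_of_agreeOn (k : ℕ) (hk : k ≤ P.m + P.K) (c : ℝ) (Q : (i : ℕ) → VecField P 0 V → VecField P i V)
    (hQ0 : ∀ A, Q 0 A = A)
    (hQoc : ∀ (i : ℕ) (A : VecField P 0 V) (μ ν : Fin P.d) (y : Site P (i + 1)), oc (Q (i + 1) A) μ ν y = c • oc (bondAvg (Q i A)) μ ν y)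
    {μ ν : Fin P.d} (hμν : μ ≠ ν) (S : (i : ℕ) → Finset (Site P i))
    (hS : ∀ i, i < k → ∀ y ∈ S (i + 1), ∀ (r : Fin P.d → Fin P.L) (s t : ℕ), s < P.L → t < P.L →
      runSite (runSite (Site.blockSite y r) μ s) ν t ∈ S i)
    (A : VecField P 0 V) (X : VecField P k V) (hXA : ∀ y ∈ S k, oc X μ ν y = oc (Q k A) μ ν y) :
    ((P.L : ℝ) ^ P.d) ^ k * ∑ y ∈ S k, ‖oc X μ ν y‖ ^ 2 ≤ (c ^ 2 * (P.L : ℝ) ^ 2) ^ k * ∑ x ∈ S 0, ‖oc A μ ν x‖ ^ 2 := by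
  have h := sum_normSq_oc_chain_le k hk c (fun i => Q i A) hμν S hS (fun i _ y _ => hQoc i A μ ν y)
  have hsum : ∑ y ∈ S k, ‖oc X μ ν y‖ ^ 2 = ∑ y ∈ S k, ‖oc (Q k A) μ ν y‖ ^ 2 :=
    Finset.sum_congr rfl fun y hy => by rw [hXA y hy]
  rw [hsum]
  simpa only [hQ0] using h

/-- **All plaquettes** (`S_i := univ`; the nesting is vacuous): `(L^d)^k · Σ_y ‖oc X μ ν y‖² ≤ (c²L²)^k · Σ_x ‖oc (H X) μ ν x‖²`.
[cite: Federbush1986PhaseCellI, 'Abelian Stability Theorem' (0.12) p.321; Balaban1984PropagatorsI, (1.21) p.21] -/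
theorem sum_normSq_oc_le_of_rightInverse_univ (k : ℕ) (hk : k ≤ P.m + P.K) (c : ℝ) (Q : (i : ℕ) → VecField P 0 V → VecField P i V)
    (hQ0 : ∀ A, Q 0 A = A)
    (hQoc : ∀ (i : ℕ) (A : VecField P 0 V) (μ ν : Fin P.d) (y : Site P (i + 1)), oc (Q (i + 1) A) μ ν y = c • oc (bondAvg (Q i A)) μ ν y)
    (H : VecField P k V → VecField P 0 V) (hH : ∀ X, Q k (H X) = X) {μ ν : Fin P.d} (hμν : μ ≠ ν) (X : VecField P k V) :
    ((P.L : ℝ) ^ P.d) ^ k * ∑ y, ‖oc X μ ν y‖ ^ 2 ≤ (c ^ 2 * (P.L : ℝ) ^ 2) ^ k * ∑ x, ‖oc (H X) μ ν x‖ ^ 2 :=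
  sum_normSq_oc_le_of_rightInverse k hk c Q hQ0 hQoc H hH hμν (fun _ => Finset.univ) (fun _ _ _ _ _ _ _ _ _ => Finset.mem_univ _) X

/-- ★ **AT `d = 4` WITH THE SCALAR `c = L` THE CONSTANT IS EXACTLY `1`**: `Σ_{y∈S_k} ‖oc X μ ν y‖² ≤ Σ_{x∈S_0} ‖oc (H X) μ ν x‖²` — the lower comparison of [Balaban1989LargeFieldII]
(1.7) at flat background with `γ₀ = 1`, in V1 plaquette currency, for every right inverse of the linearised constraint. [cite: Balaban1989LargeFieldII, (1.7) p.358; Federbush1986PhaseCellI, (0.12) p.321] -/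
theorem sum_normSq_oc_le_of_rightInverse_dfour (hd : P.d = 4) (k : ℕ) (hk : k ≤ P.m + P.K) (Q : (i : ℕ) → VecField P 0 V → VecField P i V)
    (hQ0 : ∀ A, Q 0 A = A)
    (hQoc : ∀ (i : ℕ) (A : VecField P 0 V) (μ ν : Fin P.d) (y : Site P (i + 1)), oc (Q (i + 1) A) μ ν y = (P.L : ℝ) • oc (bondAvg (Q i A)) μ ν y)
    (H : VecField P k V → VecField P 0 V) (hH : ∀ X, Q k (H X) = X) {μ ν : Fin P.d} (hμν : μ ≠ ν) (S : (i : ℕ) → Finset (Site P i))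
    (hS : ∀ i, i < k → ∀ y ∈ S (i + 1), ∀ (r : Fin P.d → Fin P.L) (s t : ℕ), s < P.L → t < P.L →
      runSite (runSite (Site.blockSite y r) μ s) ν t ∈ S i)
    (X : VecField P k V) :
    ∑ y ∈ S k, ‖oc X μ ν y‖ ^ 2 ≤ ∑ x ∈ S 0, ‖oc (H X) μ ν x‖ ^ 2 := by
  have h := sum_normSq_oc_le_of_rightInverse k hk (P.L : ℝ) Q hQ0 hQoc H hH hμν S hS X
  have hL : (0 : ℝ) < (P.L : ℝ) := by have := P.hL.2; positivity
  have h4 : ((P.L : ℝ) ^ 2 * (P.L : ℝ) ^ 2) = (P.L : ℝ) ^ P.d := by rw [hd]; ring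
  rw [h4] at h
  exact le_of_mul_le_mul_left h (by positivity)

/-- ★ **PLAQUETTE-INDEXED, WEIGHTED** (the `Σ_{p : Plaq}` shape of NODE 00's flat second variation and of the N12∕s1 window circulation sum): for a fine site weight
`ζ ≥ 0` with `ζ ≥ 1` on `S_0`, `(L^d)^k · Σ_{p ⊂ T^{(k)}, p₋ ∈ S_k} ‖oc X p‖² ≤ (c²L²)^k · Σ_{q ⊂ T^{(0)}} ζ(q₋)·‖oc (H X) q‖²` for every right inverse `H` of `Q k`.
[cite: Federbush1986PhaseCellI, 'Abelian Stability Theorem' (0.12) p.321; Balaban1989LargeFieldII, (1.6)–(1.7) pp.357–358] -/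
theorem sum_plaq_normSq_oc_le_of_rightInverse (k : ℕ) (hk : k ≤ P.m + P.K) (c : ℝ) (Q : (i : ℕ) → VecField P 0 V → VecField P i V)
    (hQ0 : ∀ A, Q 0 A = A)
    (hQoc : ∀ (i : ℕ) (A : VecField P 0 V) (μ ν : Fin P.d) (y : Site P (i + 1)), oc (Q (i + 1) A) μ ν y = c • oc (bondAvg (Q i A)) μ ν y)
    (H : VecField P k V → VecField P 0 V) (hH : ∀ X, Q k (H X) = X) (S : (i : ℕ) → Finset (Site P i))
    (hS : ∀ (μ ν : Fin P.d), μ < ν → ∀ i, i < k → ∀ y ∈ S (i + 1), ∀ (r : Fin P.d → Fin P.L) (s t : ℕ), s < P.L → t < P.L →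
      runSite (runSite (Site.blockSite y r) μ s) ν t ∈ S i)
    (ζ : Site P 0 → ℝ) (hζ0 : ∀ x, 0 ≤ ζ x) (hζ1 : ∀ x ∈ S 0, 1 ≤ ζ x) (X : VecField P k V) :
    ((P.L : ℝ) ^ P.d) ^ k * ∑ p : Plaq P k, (if p.src ∈ S k then ‖oc X p.μ p.ν p.src‖ ^ 2 else 0)
      ≤ (c ^ 2 * (P.L : ℝ) ^ 2) ^ k * ∑ q : Plaq P 0, ζ q.src * ‖oc (H X) q.μ q.ν q.src‖ ^ 2 := by
  have h := sum_plaq_normSq_oc_chain_le k hk c (fun i => Q i (H X)) S hS (fun μ ν _ i _ y _ => hQoc i (H X) μ ν y) ζ hζ0 hζ1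
  simpa only [hH X, hQ0] using h

end RightInverse

/-! ## §2½  Transport along a real-linear chart of the value space (matrices → `ℝ³` coordinates, `𝔰𝔲(2) ≃ ℝ³`, …): the chain binders `Y, hY, hYk` of
dag-n12-w4's `B16Ineq17FlatRouteConstants.gamma0_circ_le_of_flat_chain` from a matrix-level reproduction `Q k A = X` -/

section Transport

variable {V W : Type*} [AddCommGroup V] [Module ℝ V] [AddCommGroup W] [Module ℝ W]

/-- A real-linear map of the value space commutes with the ordered plaquette variable: `oc (φ∘A) = φ (oc A)`. [folklore] -/
theorem oc_comp_linearMap {j : ℕ} (φ : V →ₗ[ℝ] W) (A : VecField P j V) (μ ν : Fin P.d) (s : Site P j) :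
    oc (fun b => φ (A b)) μ ν s = φ (oc A μ ν s) := by
  simp only [oc, map_add, map_sub]

/-- **A plaquette law is transported by any real-linear chart of the values**: `oc A′ = c • oc (bondAvg A)` at `y` ⟹ `oc (φ∘A′) = c • oc (bondAvg (φ∘A))` at `y`.
[cite: Balaban1984PropagatorsI, (1.11) p.19, (1.21) p.21] -/
theorem plaquetteLaw_comp_linearMap {j : ℕ} (φ : V →ₗ[ℝ] W) (A : VecField P j V) (A' : VecField P (j + 1) V) (c : ℝ) (μ ν : Fin P.d)
    (y : Site P (j + 1)) (h : oc A' μ ν y = c • oc (bondAvg A) μ ν y) :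
    oc (fun b => φ (A' b)) μ ν y = c • oc (bondAvg fun b => φ (A b)) μ ν y := by
  have hb : (bondAvg fun b => φ (A b)) = fun c' => φ (bondAvg A c') := funext (bondAvg_comp_apply φ A)
  rw [hb]
  simp only [oc_comp_linearMap, h, map_smul]

omit [Module ℝ V] in
/-- Two bond fields that agree on the four bonds of the plaquette at `s` in the plane `(μ, ν)` have the same ordered plaquette variable there. [folklore] -/
theorem oc_congr {j : ℕ} (A B : VecField P j V) (μ ν : Fin P.d) (s : Site P j) (h1 : A ⟨s, μ⟩ = B ⟨s, μ⟩) (h2 : A ⟨s.shift μ, ν⟩ = B ⟨s.shift μ, ν⟩)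
    (h3 : A ⟨s.shift ν, μ⟩ = B ⟨s.shift ν, μ⟩) (h4 : A ⟨s, ν⟩ = B ⟨s, ν⟩) : oc A μ ν s = oc B μ ν s := by
  simp only [oc, h1, h2, h3, h4]

end Transport

section TransportIterLin

variable {n : Type*} [Fintype n] [DecidableEq n] [Nonempty n] {W : Type*} [AddCommGroup W] [Module ℝ W]

/-- ★★ **THE CHAIN `Y` OF `gamma0_circ_le_of_flat_chain` FROM THE `linAvg`-RECURSION THROUGH A LINEAR CHART**: for the recursion family `Q` (`Q (i+1) A = linAvg (Q i A)`),
a fine matrix field `A` and ANY real-linear `φ : M_n(ℂ) →ₗ[ℝ] W` (e.g. the `𝔰𝔲(2) → ℝ³` coordinates of the N12∕s1 slice), the `W`-valued chain `Y i := φ ∘ Q i A` satisfies the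
binder `hY` with `c = L` on EVERY coarse plaquette of EVERY plane: `oc (Y (i+1)) μ ν y = L • oc (bondAvg (Y i)) μ ν y`. [cite: Balaban1985Averaging, (124)-(125) p.36; Balaban1984PropagatorsI, (1.18) p.20] -/
theorem chainLaw_iterLin_comp_linearMap (Q : (i : ℕ) → (PBond P 0 → Matrix n n ℂ) → PBond P i → Matrix n n ℂ)
    (hQs : ∀ (i : ℕ) (Y : PBond P 0 → Matrix n n ℂ) (c : PBond P (i + 1)), Q (i + 1) Y c = linAvg (Q i Y) c)
    (φ : Matrix n n ℂ →ₗ[ℝ] W) (A : PBond P 0 → Matrix n n ℂ) (i : ℕ) (μ ν : Fin P.d) (y : Site P (i + 1)) :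
    oc (fun b => φ (Q (i + 1) A b)) μ ν y = (P.L : ℝ) • oc (bondAvg fun b => φ (Q i A b)) μ ν y :=
  plaquetteLaw_comp_linearMap φ (Q i A) (Q (i + 1) A) (P.L : ℝ) μ ν y (oc_iterLin_succ Q hQs A i μ ν y)

omit [Fintype n] [DecidableEq n] [Nonempty n] in
/-- ★ **THE TOP BINDER `hYk`**: if the k-fold linearised averages of `A` REPRODUCE the coarse matrix datum `X` on the four bonds of the plaquette at `y` («on the plaquettes near
`Λ`»), then the chain's top member `φ ∘ Q k A` has there the plaquette variable of `φ ∘ X` (the slice field in coordinates). [cite: Balaban1985Variational, (45) p.285] -/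
theorem oc_iterLin_comp_eq_of_reproduce (Q : (i : ℕ) → (PBond P 0 → Matrix n n ℂ) → PBond P i → Matrix n n ℂ) (φ : Matrix n n ℂ →ₗ[ℝ] W)
    (A : PBond P 0 → Matrix n n ℂ) {k : ℕ} (X : PBond P k → Matrix n n ℂ) (μ ν : Fin P.d) (y : Site P k)
    (h1 : Q k A ⟨y, μ⟩ = X ⟨y, μ⟩) (h2 : Q k A ⟨y.shift μ, ν⟩ = X ⟨y.shift μ, ν⟩) (h3 : Q k A ⟨y.shift ν, μ⟩ = X ⟨y.shift ν, μ⟩)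
    (h4 : Q k A ⟨y, ν⟩ = X ⟨y, ν⟩) :
    oc (fun b => φ (Q k A b)) μ ν y = oc (fun b => φ (X b)) μ ν y :=
  oc_congr _ _ μ ν y (by rw [h1]) (by rw [h2]) (by rw [h3]) (by rw [h4])

end TransportIterLin

/-! ## §3  The `linAvg`-recursion family: its plaquette law in §2's shape, and the A6 inhabitant of the right-inverse binder -/

section IterLin

open scoped Matrix.Norms.L2Operator

variable {n : Type*} [Fintype n] [DecidableEq n] [Nonempty n]

/-- §1 PACKAGED AS §2's HYPOTHESIS `hQoc` with `c = L`: for the `linAvg`-recursion family the plaquette law holds at EVERY coarse plaquette (not only near `Λ`).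
[cite: Balaban1985Averaging, (124)-(125) p.36; Balaban1984PropagatorsI, (1.18) p.20] -/
theorem plaquetteLaw_of_iterLin (Q : (i : ℕ) → (PBond P 0 → Matrix n n ℂ) → PBond P i → Matrix n n ℂ)
    (hQs : ∀ (i : ℕ) (Y : PBond P 0 → Matrix n n ℂ) (c : PBond P (i + 1)), Q (i + 1) Y c = linAvg (Q i Y) c) :
    ∀ (i : ℕ) (A : VecField P 0 (Matrix n n ℂ)) (μ ν : Fin P.d) (y : Site P (i + 1)),
      oc (Q (i + 1) A) μ ν y = (P.L : ℝ) • oc (bondAvg (Q i A)) μ ν y :=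
  fun i A μ ν y => oc_iterLin_succ Q hQs A i μ ν y

omit [Nonempty n] in
/-- ★ **A6: THE RIGHT-INVERSE BINDER OF §2 IS INHABITED** for the `linAvg`-recursion family: for every `k ≤ m + K` there is a FUNCTION `H` with `Q k (H X) = X` for all coarse data
`X` (and `‖H X‖_∞ ≤ ‖X‖_∞`-type control: `∀ M ≥ 0, (∀ c, ‖X c‖ ≤ M) → ∀ b, ‖H X b‖ ≤ M`, constant 1) — the route UnitScaleTilt's far-face right inverse
`exists_rightInverse_iterLin`, choice taken pointwise in `X` (sup bounds in that file's `Matrix.Norms.L2Operator` scope). [cite: Balaban1985Variational, (45) p.285; Balaban1984PropagatorsII, p.228 («Q is onto»)] -/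
theorem exists_rightInverse_iterLin_fun (Q : (i : ℕ) → (PBond P 0 → Matrix n n ℂ) → PBond P i → Matrix n n ℂ)
    (hQ0 : ∀ Y, Q 0 Y = Y) (hQs : ∀ (i : ℕ) (Y : PBond P 0 → Matrix n n ℂ) (c : PBond P (i + 1)), Q (i + 1) Y c = linAvg (Q i Y) c)
    (k : ℕ) (hk : k ≤ P.m + P.K) :
    ∃ H : (PBond P k → Matrix n n ℂ) → PBond P 0 → Matrix n n ℂ,
      (∀ X, Q k (H X) = X) ∧
        ∀ (X : PBond P k → Matrix n n ℂ) (M : ℝ), 0 ≤ M → (∀ c, ‖X c‖ ≤ M) → ∀ b, ‖H X b‖ ≤ M := by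
  classical
  -- for each `X` take the sup norm `M_X := sup_c ‖X c‖` and a right-inverse preimage bounded by it
  have hex : ∀ X : PBond P k → Matrix n n ℂ, ∃ Y : PBond P 0 → Matrix n n ℂ,
      (∀ c : PBond P k, Q k Y c = X c) ∧ ∀ b : PBond P 0, ‖Y b‖ ≤ ⨆ c, ‖X c‖ := fun X =>
    exists_rightInverse_iterLin Q hQ0 hQs k hk X (⨆ c, ‖X c‖) (Real.iSup_nonneg fun c => norm_nonneg _)
      (fun c => le_ciSup (Set.finite_range fun c' => ‖X c'‖).bddAbove c)
  choose H hH hHb using hex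
  refine ⟨H, fun X => funext (hH X), fun X M hM hX b => (hHb X b).trans ?_⟩
  exact Real.iSup_le (fun c => hX c) hM

end IterLin

end Summit.QuantumFields.YangMills.BalabanUVNodes.N12FlatConstraintPlaquetteJunction

end
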